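import Summits.QuantumFields.GaugeBoot.BootstrapTranslationReductionBoxes
import Summits.QuantumFields.GaugeBoot.BootstrapSpaceGroupReductionZd
import HarnessLib

/-!
# The box characterisation of the reduced LOWER bound; the plain bound does not see where a loop sits (gauge-boot, L1/L4 supplement)

HONEST FRAMING (cell `pub-gaugeboot`, page 1 of every file): the venture produces certified bounds
on lattice expectations at stated coupling, gauge group, dimension and torus size; NOT a mass gap,
NOT a continuum limit, NOT a string tension; NOT Yang–Mills-summit-bearing (barriers
`FixedCouplingUltralocality`, `PerturbativeInvisibility`). Structural; it certifies no number.

## Content (`SU(N)` on `ℤ^{d+1}` / `ℤ^d`, any real `β`, word level `n`)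

* `levelValuesZd_neg_suN`, `symLevelValuesZd_neg_suN`, `boxAvgObs_neg` — the feasible-value sets of
  `-P` are the negatives of those of `P`; `sSup_neg_eq_neg_sInf`, `iInf_neg_eq_neg_iSup` (real
  bookkeeping);
* ★★★ `sInf_symLevelValuesZd_eq_iSup_boxAvg_suN` — the translation-reduced LOWER bound of a Wilson
  loop `P` (word length `≤ 2n`) equals the SUPREMUM over boxes of the plain lower bounds of its box
  averages (the twin of `sSup_symLevelValuesZd_eq_iInf_boxAvg_suN`, by `P ↦ -P`);
* ★★ `levelValuesZd_comp_edgeShift_eq_suN`, `levelValuesZd_comp_edgePerm_eq_suN` — the PLAIN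
  level-`n` values of `P ∘ τ_a` and of `P ∘ π_σ` equal those of `P`: the unreduced infinite-lattice
  SDP gives a loop the same bounds wherever it sits and however it is oriented (feasibility is
  invariant under the lattice symmetries) — what the reduction adds is the identification of the
  VARIABLES, not of the bounds of a single loop.

References: as in `BootstrapTranslationReductionBoxes`. Folklore.
-/

noncomputable section

open MeasureTheory Filter Topology NormedSpace Finset
open Literature.MathematicalPhysics.QuantumFieldTheory (LatticeRep)
open Literature.MathematicalPhysics.QuantumLattice

namespace Summit.QuantumFields.GaugeBoot

open LatticeBox

/-! ## Real bookkeeping -/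

/-- `sup (-S) = - inf S` for sets of reals (from `Real.sInf_def`). -/
theorem sSup_neg_eq_neg_sInf (S : Set ℝ) : sSup (-S) = -sInf S := by
  rw [Real.sInf_def, neg_neg]

/-- `inf_k (-g k) = - sup_k (g k)` for real sequences. -/
theorem iInf_neg_eq_neg_iSup {ι : Sort*} (g : ι → ℝ) : (⨅ i, -g i) = -⨆ i, g i := by
  rw [iInf, iSup, Real.sInf_def, neg_inj]
  congr 1
  ext t
  rw [Set.mem_neg, Set.mem_range, Set.mem_range]
  constructor
  · rintro ⟨i, hi⟩
    exact ⟨i, neg_injective hi⟩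
  · rintro ⟨i, rfl⟩
    exact ⟨i, rfl⟩

section ZdSuN

variable {d : ℕ} (N : ℕ) (β : ℝ)

/-- The plain values of `-P` are the negatives of those of `P`. -/
theorem levelValuesZd_neg_suN (n : ℕ) (P : C(LGConfig d (Matrix.specialUnitaryGroup (Fin N) ℂ), ℝ)) :
    levelValuesZdSuN (d := d) N β n (-P) = -levelValuesZdSuN (d := d) N β n P := by
  ext t
  simp only [Set.mem_neg]
  constructor
  · rintro ⟨φ, hφ, h⟩
    exact ⟨φ, hφ, by rw [map_neg] at h; linarith⟩
  · rintro ⟨φ, hφ, h⟩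
    exact ⟨φ, hφ, by rw [map_neg, h, neg_neg]⟩

/-- The reduced values of `-P` are the negatives of those of `P`. -/
theorem symLevelValuesZd_neg_suN (n : ℕ) (P : C(LGConfig d (Matrix.specialUnitaryGroup (Fin N) ℂ), ℝ)) :
    symLevelValuesZdSuN (d := d) N β n (-P) = -symLevelValuesZdSuN (d := d) N β n P := by
  ext t
  simp only [Set.mem_neg]
  constructor
  · rintro ⟨φ, hφ, hinv, h⟩
    exact ⟨φ, hφ, hinv, by rw [map_neg] at h; linarith⟩
  · rintro ⟨φ, hφ, hinv, h⟩
    exact ⟨φ, hφ, hinv, by rw [map_neg, h, neg_neg]⟩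

/-- The box average is odd. -/
theorem boxAvgObs_neg (k : ℕ) (P : C(LGConfig (d + 1) (Matrix.specialUnitaryGroup (Fin N) ℂ), ℝ)) :
    boxAvgObs k (-P) = -boxAvgObs k P := by
  simp only [boxAvgObs, ContinuousMap.neg_comp, Finset.sum_neg_distrib, smul_neg]

/-- ★★★ **The translation-reduced LOWER bound of a Wilson loop on `ℤ^{d+1}` is the supremum over
boxes of the plain lower bounds of its box averages.** `SU(N)`, any real `β`, level `n`, `P` of word
length `≤ 2n`: `inf symLevelValues_n(P) = sup_k inf levelValues_n(boxAvgObs (k+1) P)`. [folklore] -/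
theorem sInf_symLevelValuesZd_eq_iSup_boxAvg_suN {n : ℕ}
    {P : C(LGConfig (d + 1) (Matrix.specialUnitaryGroup (Fin N) ℂ), ℝ)}
    (hP : P ∈ wordTruncation (ι := ZdEdge (d + 1)) (fundamentalLatticeRep N) (n + n)) :
    sInf (symLevelValuesZdSuN (d := d + 1) N β n P) =
      ⨆ k : ℕ, sInf (levelValuesZdSuN (d := d + 1) N β n (boxAvgObs (k + 1) P)) := by
  have hnP : -P ∈ wordTruncation (ι := ZdEdge (d + 1)) (fundamentalLatticeRep N) (n + n) :=
    (Submodule.span ℝ _).neg_mem hP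
  have h := sSup_symLevelValuesZd_eq_iInf_boxAvg_suN N β hnP
  rw [symLevelValuesZd_neg_suN, sSup_neg_eq_neg_sInf] at h
  simp only [boxAvgObs_neg, levelValuesZd_neg_suN, sSup_neg_eq_neg_sInf, iInf_neg_eq_neg_iSup, neg_inj] at h
  exact h

/-- ★ **The reduced lower bound is above the plain lower bound of every box average.** -/
theorem boxAvg_sInf_le_sInf_symLevelValuesZd_suN {n k : ℕ} (hk : 0 < k)
    {P : C(LGConfig (d + 1) (Matrix.specialUnitaryGroup (Fin N) ℂ), ℝ)}
    (hP : P ∈ wordTruncation (ι := ZdEdge (d + 1)) (fundamentalLatticeRep N) (n + n)) :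
    sInf (levelValuesZdSuN (d := d + 1) N β n (boxAvgObs k P)) ≤
      sInf (symLevelValuesZdSuN (d := d + 1) N β n P) := by
  obtain ⟨-, hbdd, -⟩ := bdd_levelValuesZd_suN N β
    (mem_certDomain_of_mem_wordTruncation _ (boxAvgObs_mem_wordTruncation (fundamentalLatticeRep N) k hP))
  exact csInf_le_csInf hbdd (symLevelValuesZd_nonempty N β n P)
    (symLevelValuesZd_subset_levelValuesZd_boxAvg_suN N β hk hP)

/-! ### The plain bound does not depend on where the loop sits -/

/-- ★★ **The plain level-`n` values of a translate of `P` are those of `P`** (feasibility on `ℤ^d`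
is translation invariant; any observable `P`). [folklore] -/
theorem levelValuesZd_comp_edgeShift_eq_suN (n : ℕ) (P : C(LGConfig d (Matrix.specialUnitaryGroup (Fin N) ℂ), ℝ))
    (a : Fin d → ℤ) :
    levelValuesZdSuN (d := d) N β n (P.comp (relabelCM (G := Matrix.specialUnitaryGroup (Fin N) ℂ) (edgeShift a))) =
      levelValuesZdSuN (d := d) N β n P := by
  have hstab := comp_relabelCM_edgeShift_mem_wordTruncation (d := d) (G := Matrix.specialUnitaryGroup (Fin N) ℂ)
    (fundamentalLatticeRep N) n
  ext t
  constructor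
  · rintro ⟨φ, hφ, rfl⟩
    exact ⟨translateFun a φ, hφ.translateFun (fundamentalLatticeRep N)
      (wilsonBoundaryAction_translationCovariant_suN N) hstab a, rfl⟩
  · rintro ⟨φ, hφ, rfl⟩
    refine ⟨translateFun (-a) φ, hφ.translateFun (fundamentalLatticeRep N)
      (wilsonBoundaryAction_translationCovariant_suN N) hstab (-a), ?_⟩
    rw [translateFun_apply, comp_relabelCM_edgeShift_comp, add_neg_cancel, comp_relabelCM_edgeShift_zero]

/-- ★★ **The plain level-`n` values of an axis-permuted `P` are those of `P`.** [folklore] -/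
theorem levelValuesZd_comp_edgePerm_eq_suN (n : ℕ) (P : C(LGConfig d (Matrix.specialUnitaryGroup (Fin N) ℂ), ℝ))
    (σ : Equiv.Perm (Fin d)) :
    levelValuesZdSuN (d := d) N β n (P.comp (relabelCM (G := Matrix.specialUnitaryGroup (Fin N) ℂ) (edgePerm σ))) =
      levelValuesZdSuN (d := d) N β n P := by
  have hfeas : ∀ (τ : Equiv.Perm (Fin d)) {φ : C(LGConfig d (Matrix.specialUnitaryGroup (Fin N) ℂ), ℝ) →ₗ[ℝ] ℝ},
      IsBootstrapFeasible (fundamentalLatticeRep N) (suExp N)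
        (fun e => wilsonBoundaryAction (fundamentalRep (Fin N)) {e}) β
        (wordTruncation (ι := ZdEdge d) (fundamentalLatticeRep N) n) φ →
      IsBootstrapFeasible (fundamentalLatticeRep N) (suExp N)
        (fun e => wilsonBoundaryAction (fundamentalRep (Fin N)) {e}) β
        (wordTruncation (ι := ZdEdge d) (fundamentalLatticeRep N) n)
        (φ ∘ₗ (ContinuousMap.compRightAlgHom ℝ ℝ (relabelCM (G := Matrix.specialUnitaryGroup (Fin N) ℂ) (edgePerm τ))).toLinearMap) :=
    fun τ φ hφ => hφ.comp_relabel (fundamentalLatticeRep N) (edgePerm τ) (wilsonBoundaryAction_permCovariant_suN N τ)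
      (fun v hv => comp_relabelCM_edgePerm_mem_wordTruncation (fundamentalLatticeRep N) n τ hv)
  ext t
  constructor
  · rintro ⟨φ, hφ, rfl⟩
    exact ⟨_, hfeas σ hφ, rfl⟩
  · rintro ⟨φ, hφ, rfl⟩
    refine ⟨_, hfeas σ⁻¹ hφ, ?_⟩
    change φ ((P.comp (relabelCM (edgePerm σ))).comp (relabelCM (G := Matrix.specialUnitaryGroup (Fin N) ℂ) (edgePerm σ⁻¹))) = φ P
    rw [ContinuousMap.comp_assoc, relabelCM_edgePerm_comp, inv_mul_cancel]
    congr 1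

end ZdSuN

end Summit.QuantumFields.GaugeBoot

end
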